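import Mathlib
import Literature.Computability.Complexity.LowDegreeExtension
import Literature.Computability.Complexity.LowDegreeLineCorrection
import HarnessLib

/-!
# Polynomials on lines and self-correction of a nearly-low-degree oracle (Beaver–Feigenbaum / Gemmell et al.)

Literature / complexity toolkit, fifth brick of the algebraic engine of probabilistically
checkable proofs for exponential-time computations. Once the low-degree test of
`LowDegreeTest.lean` has certified that the oracle `f : Fᵐ → F` is close to a function `g` that
passes the finite-difference test EVERYWHERE, the verifier never reads `f` directly (its query
points are structured, not random): it reads the value `g(z)` through a RANDOM LINE,
`g(z) = ∑_{i=1}^{d+1} wᵢ f(z + i·t)` with the interpolation weights `wᵢ` of the nodes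
`1, …, d + 1` at `0` — the self-corrector of Beaver–Feigenbaum 1990 / Lipton 1991 /
Gemmell–Lipton–Rubinfeld–Sudan–Wigderson 1991, §3 (Arora–Barak 2009, §8.6.2 "computing with a
corrupted low-degree polynomial", Thm. 19.19 for the multilinear/Reed–Muller case). Contents:

* `LinePoly g d` — on every line `s ↦ z + s•t` the function `g` is a one-variable polynomial
  function of degree `≤ d`; `LinePoly.coordPoly` (in particular coordinatewise, the input of the
  sumcheck of `SumcheckField.lean` via `LowDegreeExtension.axisPoly_read`); over `ZMod p`,
  `linePoly_of_fwdDiff_eq_zero`: passing the degree-`d` finite-difference test at every `(x, t)`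
  gives `LinePoly g d` (the output `g` of `LowDegreeTest.robust`);
* `selfCorrect d f z t` — the tree's line corrector `LineCorrect.correctVal`
  (`LowDegreeLineCorrection.lean`) at the nodes `scNode d = (1, …, d + 1)`, and
  **`selfCorrect_eq_of_linePoly`**: for `g` with `LinePoly g d` (and `1, …, d` nonzero in `F`)
  every line recovers `g z` exactly (Lagrange interpolation, Mathlib
  `Lagrange.eq_interpolate_of_eval_eq`);
* **`card_selfCorrect_ne_le`** (the error of the self-corrector): for ANY `f` and such `g`,
  `#{t | selfCorrect d f z t ≠ g z} ≤ (d + 1) · #{x | f x ≠ g x}` — the tree's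
  `LineCorrect.card_badDirections_le` plus exactness.

## Relation to the tree

Two self-correctors are already in the tree and this file adds NO third one:
`LowDegreeLineCorrection.lean` (`LineCorrect.lineRestrict`, `LineCorrect.correctVal`,
`correctVal_eq`, `card_badDirections_le`, `card_wrongDirections_le`) corrects a word that agrees
with an honest `MvPolynomial` of total degree `≤ d`, and `PolynomialSelfCorrection.lean`
(`PolySelfCorrect.trial/corr`) iterates it with a plurality vote. The delta here is the HYPOTHESIS:
the output of the low-degree test (`LowDegreeTest.robust`, whose vote uses the same node set
`1, …, d + 1` through `diffCoeff d`) is not a global polynomial but a function that is a degree-`d`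
polynomial ON EVERY LINE (`LinePoly`), and exactness / the error count are proved under that
hypothesis (`selfCorrect_eq_of_linePoly` generalises `LineCorrect.correctVal_eq`); the corrector
itself IS `LineCorrect.correctVal`, and `linePoly_eval_mvPolynomial` is `LineCorrect.lineRestrict`.

## References

* P. Gemmell, R. Lipton, R. Rubinfeld, M. Sudan, A. Wigderson, *Self-testing/correcting for
  polynomials and for approximate functions*, STOC 1991, §3 (self-corrector for polynomials)
  [GLRSW1991].
* D. Beaver, J. Feigenbaum, *Hiding instances in multioracle queries*, STACS 1990; R. Lipton,
  *New directions in testing*, DIMACS 1991 (random self-reducibility of low-degree polynomials).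
* S. Arora, B. Barak, *Computational Complexity: A Modern Approach*, CUP 2009, §8.6.2, §19.4
  [AroraBarakCC2009].
-/

noncomputable section

open Finset Polynomial

namespace Literature.Computability.Complexity

namespace LowDegreeTest

variable {F : Type*} [Field F] {m : ℕ}

/-! ### Polynomial on every line -/

/-- **`g` is a polynomial of degree `≤ d` on every line**: for all `z, t ∈ Fᵐ` the function
`s ↦ g(z + s•t)` is a one-variable polynomial function of degree `≤ d`.
[cite: AroraBarakCC2009, §8.6.2] -/
structure LinePoly (g : (Fin m → F) → F) (d : ℕ) : Prop where
  /-- the restriction to the line through `z` in direction `t` -/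
  poly : ∀ z t : Fin m → F, ∃ P : F[X], P.natDegree ≤ d ∧ ∀ s : F, g (z + s • t) = P.eval s

/-- A function that is a polynomial on every line is a polynomial along every axis.
[cite: AroraBarakCC2009, §8.6.2] -/
theorem LinePoly.coordPoly {g : (Fin m → F) → F} {d : ℕ} (hg : LinePoly g d) :
    LowDegreeExtension.CoordPoly g d := by
  classical
  refine ⟨fun t z => ?_⟩
  obtain ⟨P, hP, hPe⟩ := hg.poly (Function.update z t 0) (Pi.single t 1)
  refine ⟨P, hP, fun a => ?_⟩
  rw [← hPe a, LowDegreeExtension.update_add_single, zero_add]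

/-- Weakening the degree bound. [folklore] -/
theorem LinePoly.mono {g : (Fin m → F) → F} {d d' : ℕ} (hg : LinePoly g d) (h : d ≤ d') : LinePoly g d' :=
  ⟨fun z t => by
    obtain ⟨P, hP, hPe⟩ := hg.poly z t
    exact ⟨P, hP.trans h, hPe⟩⟩

/-- Moving along a line: `(z + s•t) + i•t = z + (s + i)•t`. [folklore] -/
theorem line_add_smul (z t : Fin m → F) (s i : F) : z + s • t + i • t = z + (s + i) • t := by
  rw [add_smul, add_assoc]

/-- **From the finite-difference test to polynomials on lines** (over `ZMod p`): if
`Δ_t^{d+1} g (x) = 0` for all `x, t`, then `g` is a polynomial of degree `≤ d` on every line —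
along `s ↦ z + s•t` the one-variable function satisfies `Δ_1^{d+1} = 0`
(`exists_polynomial_of_fwdDiff_iter_eq_zero`). [cite: RubinfeldSudan1996, §4] -/
theorem linePoly_of_fwdDiff_eq_zero {p : ℕ} [Fact p.Prime] {d : ℕ} (g : (Fin m → ZMod p) → ZMod p)
    (hg : ∀ x t : Fin m → ZMod p, (fwdDiff t)^[d + 1] g x = 0) : LinePoly g d := by
  refine ⟨fun z t => ?_⟩
  set u : ZMod p → ZMod p := fun s => g (z + s • t) with hu
  have hΔ : ∀ (n : ℕ) (s : ZMod p), (fwdDiff (1 : ZMod p))^[n] u s = (fwdDiff t)^[n] g (z + s • t) := by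
    intro n s
    rw [fwdDiff_iter_eq_sum_shift, fwdDiff_iter_eq_sum_shift]
    refine sum_congr rfl fun i _ => ?_
    congr 1
    rw [hu]
    simp only
    rw [nsmul_eq_mul, mul_one, ← Nat.cast_smul_eq_nsmul (ZMod p) i t, line_add_smul]
  have hzero : (fwdDiff (1 : ZMod p))^[d + 1] u = 0 := by
    funext s
    rw [hΔ, hg]
    rfl
  obtain ⟨P, hP, hPe⟩ := exists_polynomial_of_fwdDiff_iter_eq_zero u hzero
  exact ⟨P, hP, fun s => hPe s⟩

/-- **Polynomials are polynomials on lines**: the evaluation map of a polynomial in `m` variables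
of total degree `D` is `LinePoly` of degree `D` — along `s ↦ z + s•t` it is the tree's line
restriction `LineCorrect.lineRestrict P z t` (`natDegree_lineRestrict_le`, `eval_lineRestrict`).
(In particular the honest low-degree extension is exactly self-corrected.) [cite: AroraBarakCC2009, §8.6.2] -/
theorem linePoly_eval_mvPolynomial (P : MvPolynomial (Fin m) F) :
    LinePoly (fun z => MvPolynomial.eval z P) P.totalDegree :=
  ⟨fun z t => ⟨LineCorrect.lineRestrict P z t, LineCorrect.natDegree_lineRestrict_le P z t,
    fun s => (LineCorrect.eval_lineRestrict P z t s).symm⟩⟩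

/-! ### The self-corrector -/

section SelfCorrect

/-- The interpolation nodes `1, …, d + 1` (indexed by `Fin (d + 1)`: `i ↦ i + 1`). [folklore] -/
def scNode (d : ℕ) : Fin (d + 1) → F := fun i => (((i : ℕ) + 1 : ℕ) : F)

/-- **The self-corrector**: the value at `z` predicted from the `d + 1` values on the line in
direction `t` — the tree's `LineCorrect.correctVal` at the nodes `1, …, d + 1`.
[cite: GLRSW1991, §3] [cite: AroraBarakCC2009, §8.6.2] -/
def selfCorrect (d : ℕ) (f : (Fin m → F) → F) (z t : Fin m → F) : F :=
  LineCorrect.correctVal (scNode (F := F) d) f z t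

/-- The nodes `1, …, d + 1` are distinct when `1, …, d` are nonzero in `F`. [folklore] -/
theorem scNode_injective {d : ℕ} (hunit : ∀ i : ℕ, 1 ≤ i → i ≤ d → (i : F) ≠ 0) :
    Function.Injective (scNode (F := F) d) := by
  have key : ∀ i j : Fin (d + 1), scNode (F := F) d i = scNode d j → (i : ℕ) < j → False := by
    intro i j h hij
    have h' : ((i : ℕ) : F) = (j : ℕ) := by
      have h1 := h
      simp only [scNode, Nat.cast_add, Nat.cast_one, add_left_inj] at h1
      exact h1
    have hsub : (((j : ℕ) - i : ℕ) : F) = 0 := by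
      rw [Nat.cast_sub hij.le, h', sub_self]
    exact hunit ((j : ℕ) - i) (by omega) (by have := j.2; omega) hsub
  intro i j h
  by_contra hne
  rcases lt_or_gt_of_ne (Fin.val_injective.ne hne) with hij | hij
  · exact key i j h hij
  · exact key j i h.symm hij

/-- The nodes are nonzero when `1, …, d + 1` are nonzero in `F`. [folklore] -/
theorem scNode_ne_zero {d : ℕ} (hunit : ∀ i : ℕ, 1 ≤ i → i ≤ d + 1 → (i : F) ≠ 0) (i : Fin (d + 1)) :
    scNode (F := F) d i ≠ 0 :=
  hunit _ (by omega) (by have := i.2; omega)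

/-- **The self-corrector is exact on a function that is a polynomial on every line**
(generalising `LineCorrect.correctVal_eq` from a global polynomial to `LinePoly`): the restriction
to the line has degree `≤ d <` the number of nodes, so it is the interpolant, and its value at `0`
is `g z`. [cite: GLRSW1991, §3] [cite: AroraBarakCC2009, §8.6.2] -/
theorem selfCorrect_eq_of_linePoly {d : ℕ} (hunit : ∀ i : ℕ, 1 ≤ i → i ≤ d → (i : F) ≠ 0)
    {g : (Fin m → F) → F} (hg : LinePoly g d) (z t : Fin m → F) : selfCorrect d g z t = g z := by
  classical
  obtain ⟨P, hP, hPe⟩ := hg.poly z t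
  have hdeg : P.degree < ((univ : Finset (Fin (d + 1))).card : WithBot ℕ) := by
    rw [card_univ, Fintype.card_fin]
    exact degree_le_natDegree.trans_lt (by exact_mod_cast Nat.lt_succ_of_le hP)
  have heq := Lagrange.eq_interpolate_of_eval_eq (r := fun i => g (z + scNode (F := F) d i • t))
    (scNode_injective hunit).injOn hdeg (fun i _ => (hPe _).symm)
  have hz : g z = P.eval 0 := by rw [← hPe 0, zero_smul, add_zero]
  rw [hz, heq]
  rfl

/-- **The error of the self-corrector.** For any oracle `f` and any `g` that is a polynomial on
every line, the directions `t` on which the self-corrected value at `z` is wrong number at most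
`(d + 1) · #{x | f x ≠ g x}`: if all `d + 1` query points avoid the disagreement set, the corrector
returns `g z` (exactness), and few directions meet the disagreement set (the tree's
`LineCorrect.card_badDirections_le`). [cite: GLRSW1991, §3] [cite: AroraBarakCC2009, §8.6.2] -/
theorem card_selfCorrect_ne_le [Fintype F] [DecidableEq F] {d : ℕ}
    (hunit : ∀ i : ℕ, 1 ≤ i → i ≤ d + 1 → (i : F) ≠ 0) (f : (Fin m → F) → F)
    {g : (Fin m → F) → F} (hg : LinePoly g d) (z : Fin m → F) :
    (univ.filter fun t : Fin m → F => selfCorrect d f z t ≠ g z).card ≤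
      (d + 1) * (univ.filter fun x : Fin m → F => f x ≠ g x).card := by
  classical
  have hunit' : ∀ i : ℕ, 1 ≤ i → i ≤ d → (i : F) ≠ 0 := fun i h1 h2 => hunit i h1 (by omega)
  refine le_trans (card_le_card fun t ht => ?_)
    (LineCorrect.card_badDirections_le (scNode (F := F) d) (univ.filter fun x : Fin m → F => f x ≠ g x) z
      (scNode_ne_zero hunit))
  rw [mem_filter] at ht ⊢
  refine ⟨mem_univ _, ?_⟩
  by_contra hall
  push Not at hall
  have hagree : ∀ i, f (z + scNode (F := F) d i • t) = g (z + scNode (F := F) d i • t) := fun i => by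
    by_contra hne
    exact hall i (mem_filter.2 ⟨mem_univ _, hne⟩)
  refine ht.2 ?_
  rw [← selfCorrect_eq_of_linePoly hunit' hg z t]
  unfold selfCorrect LineCorrect.correctVal
  simp_rw [hagree]

end SelfCorrect

end LowDegreeTest

end Literature.Computability.Complexity

end
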